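import Literature.Probability.Percolation.KozmaNitzanPreFKG
import HarnessLib

/-! # Crux `PercNearOneGluing.AdditiveGluing` (stmt-CriticalPhenomena-4576) — quantitative set-gluing inequalities
# ("weakest-port gluing", base cases; seat (b) V⁺-form, depth prover `png-dp-vplus`, gen 7)

Support file (`--supports stmt-CriticalPhenomena-4576`); no definitions, no named facts, no sorries.

For bond percolation `μ = prodBernoulli w` on a finite weighted graph and a vertex set `B ∌ b`, gluing `B` into one vertex raises the
two-point function of a vertex `x` from `μ(x ↔ b)` to `μ_{/B}(x ↔ b) := μ({x ↔ b} ∪ ({x ↔ B} ∩ {B ↔ b}))`.  The conjectured engine behind the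
registered stub `stub_fingerML3_vp` (conjecture G, memo MEMO-gen7 of run/shared/lean/prim/prim-png-dp-vplus/) is the *weakest-port gluing
lemma*: `μ(B ↔ b) − μ_{/B}(x ↔ b) ≥ μ(u ↔ b) − μ(x ↔ b)` for the weakest "port" `u` of `B`.  Here we land its two proved cases:

* `setGlue_real_le_add_posPart` — the SLACK regime, for every `v ∈ B` and every `x`:
  `μ_{/B}(x ↔ b) ≤ μ(B ↔ b) + (μ(x ↔ b) − μ(v ↔ b))⁺`  (Kozma–Nitzan Lemma 3(ii) with slack, `Q = {x ↮ B}`).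
* `pairGlue_real_ge` — the PAIR case (`B = {u, v}`, `μ(u↔b) ≤ μ(v↔b)`), for EVERY vertex `x`:
  `μ({u,v} ↔ b) − μ_{/{u,v}}(x ↔ b) ≥ μ(u ↔ b) − μ(x ↔ b)`, i.e. `μ(v↔b, u↮b) ≥ μ(x↮b, x↔{u,v}↔b)`: the gain of any vertex from gluing a
  pair is at most the amount by which the pair beats its weaker member.  (New; proof: one application of Lemma 3(ii) with the decreasing
  event `{u ↮ v} ∩ {u ↮ x}` of the cluster of `u`.)
[cite: KozmaNitzan2024, Lemma 3(ii) (pp. 6–7), Lemma 5 (p. 13)]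
-/

namespace Summit.CriticalPhenomena.PercolationContinuityZ3.Theorems

open MeasureTheory Set
open Literature.Probability.LatticeModels (prodBernoulli)
open Literature.Probability.Percolation

noncomputable section
open Classical

section PairGluing

variable {V : Type*} [Fintype V]

/-- **Set gluing, slack regime.**  For every vertex set `B`, every `v ∈ B` and every vertex `x`:
`μ({x↔b} ∪ ({x↔B} ∩ {B↔b})) ≤ μ(B↔b) + (μ(x↔b) − μ(v↔b))⁺`.  (On `{x ↮ B}` the glued connection of `x` is `{x↔b, x↮B}`, whose mass is
at most `μ(v↔b, x↮B) + δ` by Lemma 3(ii) with slack `δ = (μ(x↔b) − μ(v↔b))⁺`; on `{x ↔ B}` it is contained in `{B ↔ b}`.)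
[cite: KozmaNitzan2024, Lemma 3(ii) (pp. 6–7)] -/
theorem setGlue_real_le_add_posPart (w : Sym2 V → unitInterval) (B : Set V) (x v b : V) (hv : v ∈ B) :
    (prodBernoulli w).real (openConn x b ∪ ((⋃ y ∈ B, openConn x y) ∩ ⋃ y ∈ B, openConn y b)) ≤
      (prodBernoulli w).real (⋃ y ∈ B, openConn y b) +
        max 0 ((prodBernoulli w).real (openConn x b) - (prodBernoulli w).real (openConn v b)) := by
  set μ := prodBernoulli w with hμ
  set δ : ℝ := max 0 (μ.real (openConn x b) - μ.real (openConn v b)) with hδ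
  set Dx : Set (BondConfig V) := {ω | ∀ y ∈ B, ¬ (openGraph ω).Reachable x y} with hDx
  set UB : Set (BondConfig V) := ⋃ y ∈ B, openConn y b with hUB
  have hδ0 : 0 ≤ δ := le_max_left _ _
  have hhyp : μ.real (openConn x b) ≤ μ.real (openConn v b) + δ := by
    have := le_max_right 0 (μ.real (openConn x b) - μ.real (openConn v b))
    linarith
  -- Lemma 3(ii) with slack, `Q = {x ↮ B}`
  have hL3 : μ.real (openConn x b ∩ Dx) ≤ μ.real (openConn v b ∩ Dx) + δ := by
    have key := KozmaNitzan2024_lemma3_ii w x v b hδ0 hhyp (KNPreFKG.isLowerSet_disconnFamily x B)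
    rw [← KNPreFKG.setOf_forall_not_reachable_eq] at key
    exact key
  -- set inclusions
  have hsub : openConn x b ∪ ((⋃ y ∈ B, openConn x y) ∩ UB) ⊆ (openConn x b ∩ Dx) ∪ (UB ∩ Dxᶜ) := by
    intro ω hω
    by_cases hD : ω ∈ Dx
    · rcases hω with hxb | ⟨hxB, -⟩
      · exact Or.inl ⟨hxb, hD⟩
      · exfalso
        simp only [mem_iUnion, exists_prop] at hxB
        obtain ⟨y, hy, hxy⟩ := hxB
        exact hD y hy hxy
    · right
      refine ⟨?_, hD⟩
      rcases hω with hxb | ⟨-, hUb⟩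
      · -- `x ↔ b` and `x ↔ y` for some `y ∈ B` give `y ↔ b`
        simp only [hDx, mem_setOf_eq, not_forall, not_not, exists_prop] at hD
        obtain ⟨y, hy, hxy⟩ := hD
        simp only [hUB, mem_iUnion, exists_prop]
        exact ⟨y, hy, hxy.symm.trans hxb⟩
      · exact hUb
  have hVD : openConn v b ∩ Dx ⊆ UB ∩ Dx := by
    rintro ω ⟨hvb, hD⟩
    refine ⟨?_, hD⟩
    simp only [hUB, mem_iUnion, exists_prop]
    exact ⟨v, hv, hvb⟩
  have hsplit : μ.real (UB ∩ Dx) + μ.real (UB ∩ Dxᶜ) = μ.real UB := by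
    have := measureReal_inter_add_sdiff (μ := μ) (s := UB) (t := Dx) (h := measure_ne_top _ _) MeasurableSet.of_discrete
    rw [Set.sdiff_eq] at this
    exact this
  calc μ.real (openConn x b ∪ ((⋃ y ∈ B, openConn x y) ∩ UB))
      ≤ μ.real ((openConn x b ∩ Dx) ∪ (UB ∩ Dxᶜ)) := measureReal_mono hsub (measure_ne_top _ _)
    _ ≤ μ.real (openConn x b ∩ Dx) + μ.real (UB ∩ Dxᶜ) := measureReal_union_le _ _
    _ ≤ μ.real (openConn v b ∩ Dx) + δ + μ.real (UB ∩ Dxᶜ) := by linarith [hL3]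
    _ ≤ μ.real (UB ∩ Dx) + δ + μ.real (UB ∩ Dxᶜ) := by linarith [measureReal_mono (μ := μ) hVD (measure_ne_top _ _)]
    _ = μ.real UB + δ := by linarith [hsplit]

/-- **Pair gluing lemma** (the pair case of the weakest-port gluing lemma).  If `μ(u↔b) ≤ μ(v↔b)` then for EVERY vertex `x`:
`μ({u↔b} ∪ {v↔b}) − μ({x↔b} ∪ (({x↔u} ∪ {x↔v}) ∩ ({u↔b} ∪ {v↔b}))) ≥ μ(u↔b) − μ(x↔b)`,
equivalently `μ(v↔b, u↮b) ≥ μ(x↮b, x↔{u,v}↔b)`: gluing the pair `{u,v}` helps no vertex by more than the pair beats its weaker member.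
Proof: the gain event splits into `{x↔u↮b, v↔b}` (inside `{v↔b, u↮v, u↔x}`) and `{x↔v↮b, u↔b}` (inside `{u↔b, u↮v, u↮x}`, which
Lemma 3(ii) maps into `{v↔b, u↮v, u↮x}`); the two targets are disjoint parts of `{v↔b, u↮b}`.
[cite: KozmaNitzan2024, Lemma 3(ii) (pp. 6–7)] -/
theorem pairGlue_real_ge (w : Sym2 V → unitInterval) (u v x b : V)
    (huv : (prodBernoulli w).real (openConn u b) ≤ (prodBernoulli w).real (openConn v b)) :
    (prodBernoulli w).real (openConn u b) - (prodBernoulli w).real (openConn x b) ≤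
      (prodBernoulli w).real (openConn u b ∪ openConn v b) -
        (prodBernoulli w).real (openConn x b ∪ ((openConn x u ∪ openConn x v) ∩ (openConn u b ∪ openConn v b))) := by
  set μ := prodBernoulli w with hμ
  set U : Set (BondConfig V) := openConn u b with hU
  set Vb : Set (BondConfig V) := openConn v b with hVb
  set Xb : Set (BondConfig V) := openConn x b with hXb
  set G : Set (BondConfig V) := openConn x b ∪ ((openConn x u ∪ openConn x v) ∩ (openConn u b ∪ openConn v b)) with hG
  set D : Set (BondConfig V) := {ω | ∀ y ∈ ({v, x} : Set V), ¬ (openGraph ω).Reachable u y} with hD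
  set E1 : Set (BondConfig V) := Vb ∩ {ω | ¬ (openGraph ω).Reachable u v ∧ (openGraph ω).Reachable u x} with hE1
  -- `μ(U ∪ Vb) = μ(U) + μ(Vb \ U)` and `μ(G) = μ(Xb) + μ(G \ Xb)`
  have h1 : μ.real (U ∪ Vb) = μ.real U + μ.real (Vb \ U) := by
    rw [← Set.union_sdiff_self, measureReal_union Set.disjoint_sdiff_right MeasurableSet.of_discrete]
  have h2 : μ.real G = μ.real Xb + μ.real (G \ Xb) := by
    have hXG : Xb ⊆ G := Set.subset_union_left
    rw [← measureReal_union Set.disjoint_sdiff_right MeasurableSet.of_discrete, Set.union_sdiff_cancel hXG]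
  -- Lemma 3(ii): `μ(U ∩ D) ≤ μ(Vb ∩ D)`
  have hL3 : μ.real (U ∩ D) ≤ μ.real (Vb ∩ D) :=
    KozmaNitzan2024_lemma3_ii_notConn w u v b ({v, x} : Set V) huv
  -- the gain event splits
  have hsub : G \ Xb ⊆ E1 ∪ (U ∩ D) := by
    rintro ω ⟨hωG, hxb⟩
    have hxb' : ¬ (openGraph ω).Reachable x b := hxb
    rcases hωG with h | ⟨hxuv, hub⟩
    · exact absurd h hxb
    by_cases hxu : (openGraph ω).Reachable x u
    · -- `x ↔ u`: then `u ↮ b`, so `v ↔ b`, `u ↮ v`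
      have hnub : ¬ (openGraph ω).Reachable u b := fun h => hxb' (hxu.trans h)
      have hvb : (openGraph ω).Reachable v b := by
        rcases hub with h | h
        · exact absurd h hnub
        · exact h
      refine Or.inl ⟨hvb, ?_, hxu.symm⟩
      exact fun h => hnub (h.trans hvb)
    · -- `x ↔ v`: then `v ↮ b`, so `u ↔ b`, `u ↮ v`, `u ↮ x`
      have hxv : (openGraph ω).Reachable x v := by
        rcases hxuv with h | h
        · exact absurd h hxu
        · exact h
      have hnvb : ¬ (openGraph ω).Reachable v b := fun h => hxb' (hxv.trans h)
      have hub' : (openGraph ω).Reachable u b := by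
        rcases hub with h | h
        · exact h
        · exact absurd h hnvb
      refine Or.inr ⟨hub', ?_⟩
      intro y hy
      rcases hy with rfl | rfl
      · exact fun h => hnvb (h.symm.trans hub')
      · exact fun h => hxu h.symm
  -- both targets lie in `Vb \ U`, disjointly
  have hE1sub : E1 ⊆ Vb \ U := by
    rintro ω ⟨hvb, hnuv, -⟩
    exact ⟨hvb, fun hub => hnuv (hub.trans (hvb : (openGraph ω).Reachable v b).symm)⟩
  have hVDsub : Vb ∩ D ⊆ Vb \ U := by
    rintro ω ⟨hvb, hDω⟩
    refine ⟨hvb, fun hub => ?_⟩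
    exact hDω v (by simp) (hub.trans (hvb : (openGraph ω).Reachable v b).symm)
  have hdisj : Disjoint E1 (Vb ∩ D) := by
    rw [Set.disjoint_left]
    rintro ω ⟨-, -, hux⟩ ⟨-, hDω⟩
    exact hDω x (by simp) hux
  have h3 : μ.real (G \ Xb) ≤ μ.real (Vb \ U) := by
    calc μ.real (G \ Xb) ≤ μ.real (E1 ∪ (U ∩ D)) := measureReal_mono hsub (measure_ne_top _ _)
      _ ≤ μ.real E1 + μ.real (U ∩ D) := measureReal_union_le _ _
      _ ≤ μ.real E1 + μ.real (Vb ∩ D) := by linarith [hL3]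
      _ = μ.real (E1 ∪ (Vb ∩ D)) := (measureReal_union hdisj MeasurableSet.of_discrete).symm
      _ ≤ μ.real (Vb \ U) := measureReal_mono (Set.union_subset hE1sub hVDsub) (measure_ne_top _ _)
  linarith [h1, h2, h3]


/-- **SWAP lemma** (re-rooting the cluster of `b` from `u` to the stronger vertex `v` while `x` rides on `v`).  If `μ(u↔b) ≤ μ(v↔b)` and
`u ≠ v` then for every vertex `x`:  `μ(u↔b, v↔x, u↮v) ≤ μ(v↔b, v↔x, u↮v)`.  Proof ("BHK three times"): given `D = {u ↮ v}`, the increasing events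
`{b ∈ C(u)}` and `{x ∈ C(v)}` of the two clusters are negatively correlated (BHK 2006 Thm 1.5), `μ(D, u↔b) ≤ μ(D, v↔b)` (the hypothesis, Lemma 3(ii)
with `Q = {u↮v}`), and `{b ∈ C(v)}`, `{x ∈ C(v)}` are positively correlated given `{v ↮ u}` (BHK 2006 Thm 1.3).  This is the transport step behind the
weakest-port gluing lemma (memo MEMO-gen7 §2): it moves all configurations with `x ∈ C(v)` at once and contains `pairGlue_real_ge`.
[cite: VandenbergHaggstromKahn2005, Thms 1.3, 1.5; KozmaNitzan2024, Lemma 3(ii) (pp. 6–7)] -/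
theorem swap_real_le (w : Sym2 V → unitInterval) (u v x b : V) (huv_ne : u ≠ v)
    (huv : (prodBernoulli w).real (openConn u b) ≤ (prodBernoulli w).real (openConn v b)) :
    (prodBernoulli w).real ({ω : BondConfig V | ¬ (openGraph ω).Reachable u v} ∩ (openConn u b ∩ openConn v x)) ≤
      (prodBernoulli w).real ({ω : BondConfig V | ¬ (openGraph ω).Reachable u v} ∩ (openConn v b ∩ openConn v x)) := by
  set μ := prodBernoulli w with hμ
  set D : Set (BondConfig V) := {ω | ¬ (openGraph ω).Reachable u v} with hD
  -- the BHK events in cluster form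
  have hUb : ({ω : BondConfig V | openEdgeCluster ω u ∈ KNPreFKG.connFamily u b}) = openConn u b :=
    (KNPreFKG.openConn_eq_setOf_connFamily u b).symm
  have hVb : ({ω : BondConfig V | openEdgeCluster ω v ∈ KNPreFKG.connFamily v b}) = openConn v b :=
    (KNPreFKG.openConn_eq_setOf_connFamily v b).symm
  have hVx : ({ω : BondConfig V | openEdgeCluster ω v ∈ KNPreFKG.connFamily v x}) = openConn v x :=
    (KNPreFKG.openConn_eq_setOf_connFamily v x).symm
  -- (1) negative correlation of `{b ∈ C(u)}` and `{x ∈ C(v)}` given `u ↮ v`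
  have h1 := KNPreFKG.bhk_two_upper_upper w u v huv_ne (KNPreFKG.isUpperSet_connFamily u b) (KNPreFKG.isUpperSet_connFamily v x)
  rw [hUb, hVx] at h1
  -- (2) the hypothesis on `D`: Lemma 3(ii) with `Q = {u ↮ v}`
  have h2 : μ.real (D ∩ openConn u b) ≤ μ.real (D ∩ openConn v b) := by
    have key := KozmaNitzan2024_lemma3_ii_notConn w u v b ({v} : Set V) huv
    have hDv : {ω : BondConfig V | ∀ y ∈ ({v} : Set V), ¬ (openGraph ω).Reachable u y} = D := by
      ext ω; simp [hD]
    rw [hDv, Set.inter_comm (openConn u b), Set.inter_comm (openConn v b)] at key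
    exact key
  -- (3) positive correlation of `{b ∈ C(v)}` and `{x ∈ C(v)}` given `v ↮ u`
  have h3 := KNPreFKG.bhk_one_upper_upper w v ({u} : Set V) (by simpa using huv_ne.symm)
    (KNPreFKG.isUpperSet_connFamily v b) (KNPreFKG.isUpperSet_connFamily v x)
  have hDu : {ω : BondConfig V | ∀ y ∈ ({u} : Set V), ¬ (openGraph ω).Reachable v y} = D := by
    ext ω
    simp only [Set.mem_singleton_iff, forall_eq, Set.mem_setOf_eq, hD]
    exact not_congr ⟨SimpleGraph.Reachable.symm, SimpleGraph.Reachable.symm⟩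
  rw [hDu, hVb, hVx] at h3
  -- combine
  by_cases hD0 : μ.real D = 0
  · have : μ.real (D ∩ (openConn u b ∩ openConn v x)) = 0 :=
      le_antisymm ((measureReal_mono Set.inter_subset_left (measure_ne_top _ _)).trans hD0.le) measureReal_nonneg
    rw [this]
    exact measureReal_nonneg
  · have hDpos : 0 < μ.real D := lt_of_le_of_ne measureReal_nonneg (Ne.symm hD0)
    have hchain : μ.real D * μ.real (D ∩ (openConn u b ∩ openConn v x)) ≤
        μ.real D * μ.real (D ∩ (openConn v b ∩ openConn v x)) := by
      calc μ.real D * μ.real (D ∩ (openConn u b ∩ openConn v x))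
          ≤ μ.real (D ∩ openConn u b) * μ.real (D ∩ openConn v x) := h1
        _ ≤ μ.real (D ∩ openConn v b) * μ.real (D ∩ openConn v x) :=
            mul_le_mul_of_nonneg_right h2 measureReal_nonneg
        _ ≤ μ.real D * μ.real (D ∩ (openConn v b ∩ openConn v x)) := h3
    exact le_of_mul_le_mul_left hchain hDpos

end PairGluing

end

end Summit.CriticalPhenomena.PercolationContinuityZ3.Theorems
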